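import Mathlib.RingTheory.MvPolynomial.Homogeneous
import Mathlib.RingTheory.AlgebraicIndependent.Transcendental
import Mathlib.FieldTheory.IntermediateField.Adjoin.Defs
import Mathlib.Analysis.SpecialFunctions.Exp
import Mathlib.SetTheory.Cardinal.Basic
import HarnessLib

/-!
# Quadratic relations between logarithms of algebraic numbers (Roy–Waldschmidt 1995/1997)

Named fact (D-0014: published, not yet formalised; users take `(h : <name>)`):

* `royWaldschmidt_quadratic_thm_0_2` — Roy–Waldschmidt, *Approximation diophantienne et
  indépendance algébrique de logarithmes*, Ann. Sci. ÉNS (4) 30 (1997) 753–796, **Théorème 0.2**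
  (p. 755; announced as Theorem 2 of Roy–Waldschmidt, Proc. Japan Acad. 71A (1995) 151–153):
  "Soit `V ⊆ ℂⁿ` le lieu des zéros dans `ℂⁿ` d'un polynôme `P ∈ ℚ[X₁,…,Xₙ]` homogène de degré
  `≤ 2` et soit `(λ₁,…,λₙ)` un point de `V` à coordonnées dans `𝓛`. Alors, ou bien `(λ₁,…,λₙ)` est
  contenu dans un sous-espace vectoriel de `ℂⁿ` défini sur `ℚ` et contenu dans `V`, ou bien le corps
  `ℚ(λ₁,…,λₙ)` est de degré de transcendance `≥ 2` sur `ℚ`."  Here `𝓛 = exp⁻¹(ℚ̄ˣ)` is the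
  `ℚ`-vector space of logarithms of algebraic numbers.

Its corollary singled out in the Résumé/Abstract (p. 753) — "if `log α₁, …, log αₙ` are
`ℚ`-linearly independent logarithms of algebraic numbers in a field of transcendence degree `1`
over `ℚ`, then for any non zero quadratic form `Q ∈ ℚ[X₁,…,Xₙ]`, the number `Q(log α₁,…,log αₙ)`
does not vanish" — is NOT a second named fact: it is the PROVED theorem
`royWaldschmidt_quadraticForm_ne_zero_of_trdeg_one_of_thm_0_2 (h : royWaldschmidt_quadratic_thm_0_2) …`
of the sibling file `QuadraticRelationsLogarithmsProofs.lean` (from Théorème 0.2 by linear algebra: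
a subspace of `ℂⁿ` defined over `ℚ` containing a point with `ℚ`-linearly independent coordinates is
`ℂⁿ`, which is not contained in `V` when `Q ≠ 0`).  It was first recorded here as the named fact
`royWaldschmidt_quadraticForm_ne_zero_of_trdeg_one` and merged back into Théorème 0.2 on review
(D-0026/D-0027: its only proof is a proof of Théorème 0.2); its cases `n ≤ 2`
(`RoyWaldschmidt1997.royWaldschmidt_quadraticForm_ne_zero_of_trdeg_one_of_le_two`,
`…BakerProofs.lean`), `n = 3` with `Q` isotropic over `ℚ`
(`RoyWaldschmidt1997.royWaldschmidt_quadraticForm_ne_zero_of_trdeg_one_three_of_isotropic`,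
`…IsotropicProofs.lean`) and `Q = X₁² − X₀X₂`, `X₀X₃ − X₁X₂` (Brownawell–Waldschmidt,
`…BWProofs.lean`) are proved UNCONDITIONALLY in the tree.

These are the only UNCONDITIONAL results in print on homogeneous quadratic relations among
`≤ 4` logarithms of algebraic numbers beyond the linear subgroup theorem range (the general case —
e.g. three `ℚ`-linearly independent logarithms in geometric progression, `λ₀λ₂ = λ₁²`, Roy's
"no-go" surface `xy = z²` — is the open four exponentials conjecture,
`Literature.NumberTheory.Transcendental.FourExponentialsConjecture`; cf. the in-tree barrier
`Literature.Barriers.Schanuel.LinearSubgroupMethodLimit`).  With `P = X₁X₄ − X₂X₃` Théorème 0.2 is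
the Brownawell–Waldschmidt solution of the four exponentials conjecture in transcendence degree 1
(`Literature.Barriers.Schanuel.smallTrdeg_thm_2_9_two_two`, Roy–Waldschmidt 1995 Theorem 1).

Grounds (as the known special case `trdeg ℚ(x) = 1`) the route items
`Summit.Schanuel.Schanuel.Theses.GeodesicLengthsGP3.RealGP3` (P = X₁² − X₀X₂),
`….AnisotropicPDQ21` and the first conjunct of `….Target` (P = X₀² + D X₁² − C X₂²) of
route-Schanuel-GeodesicLengthsGP3; those items (no transcendence-degree hypothesis) are STRONGER
than print.

## What is NOT here

No proofs (the printed proof uses a Wirsing-type simultaneous approximation theorem in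
transcendence degree 1, Laurent's interpolation determinants, Waldschmidt's effective linear
subgroup theorem and Clifford algebras, Lemme 7.6; the printed reduction chain Théorème 0.2 ⇐ 0.1 ⇐
Corollaire 1.4 ⇐ 1.3 ⇐ Théorème 1.1, Théorème 3.2 and Proposition 6.1 are proved in the sibling
`QuadraticRelationsLogarithms*.lean` files).  Not the general Théorème 1.1 / 7.1 of the paper as
facts, nor Corollaire 7.2 (curves of degree `d` with `4d + 2 < n(n+1)`), 7.3–7.5.

## References

* [RoyWaldschmidt1997ENS] D. Roy, M. Waldschmidt, *Approximation diophantienne et indépendance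
  algébrique de logarithmes*, Ann. Sci. École Norm. Sup. (4) 30 (1997), 753–796 — Résumé p. 753,
  Théorème 0.2 p. 755, proof §7 p. 791 (lit key paper:doi-10-1016-s0012-9593-97-89938-7).
* [RoyWaldschmidt1995] D. Roy, M. Waldschmidt, *Quadratic relations between logarithms of algebraic
  numbers*, Proc. Japan Acad. Ser. A 71 (1995), 151–153, Theorems 1–2.
-/

noncomputable section

open Complex

namespace Literature.NumberTheory.Transcendental

/-- The `ℂ`-subspace of `ℂⁿ` spanned by a set of RATIONAL vectors — "un sous-espace vectoriel de
`ℂⁿ` défini sur `ℚ`" (a subspace is defined over `ℚ` iff it is the `ℂ`-span of its rational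
points, iff it is of this form). [folklore] -/
def ratSpan {n : ℕ} (s : Set (Fin n → ℚ)) : Submodule ℂ (Fin n → ℂ) :=
  Submodule.span ℂ ((fun v : Fin n → ℚ => fun i => ((v i : ℚ) : ℂ)) '' s)

/-- **Roy–Waldschmidt 1997, Théorème 0.2** (quadratic relations between logarithms of algebraic
numbers in transcendence degree `1`): let `P ∈ ℚ[X₁,…,Xₙ]` be homogeneous of degree `≤ 2`, `V ⊆ ℂⁿ`
its zero locus, and `λ = (λ₁,…,λₙ) ∈ V` a point whose coordinates are logarithms of algebraic
numbers (`e^{λᵢ} ∈ ℚ̄`). Then either `λ` lies in a vector subspace of `ℂⁿ` defined over `ℚ` and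
contained in `V`, or the field `ℚ(λ₁,…,λₙ)` has transcendence degree `≥ 2` over `ℚ`.
"Homogène de degré `≤ 2`" is rendered as `P.IsHomogeneous k` for some `k ≤ 2`; the subspace
defined over `ℚ` as `ratSpan s` for a set `s` of rational vectors. Announced as Theorem 2 of
Roy–Waldschmidt, Proc. Japan Acad. 71A (1995). Named fact; users take
`(h : royWaldschmidt_quadratic_thm_0_2)`.
[cite: RoyWaldschmidt1997ENS, Théorème 0.2 (p. 755; proof §7 p. 791)] -/
def royWaldschmidt_quadratic_thm_0_2 : Prop :=
  ∀ (n k : ℕ) (P : MvPolynomial (Fin n) ℚ), k ≤ 2 → P.IsHomogeneous k →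
    ∀ l : Fin n → ℂ, (∀ i, IsAlgebraic ℚ (cexp (l i))) → MvPolynomial.aeval l P = 0 →
      (∃ s : Set (Fin n → ℚ), l ∈ ratSpan s ∧ ∀ w ∈ ratSpan s, MvPolynomial.aeval w P = 0) ∨
      (2 : Cardinal) ≤ Algebra.trdeg ℚ ↥(IntermediateField.adjoin ℚ (Set.range l))

end Literature.NumberTheory.Transcendental
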